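import Literature.Computability.QuantumComplexity.QTMCircuitLayout
import Literature.Computability.QuantumComplexity.QTMCircuitGateSet
import Literature.Computability.QuantumComplexity.RevTableau
import HarnessLib

/-!
# The circuit simulating a quantum Turing machine, III: the circuits and the exact simulation

Fourth file of the formalisation of the simulation of quantum Turing machines by quantum
circuits (Yao 1993; Nishimura–Ozawa 2002, Thm. 4.3) in Bernstein–Vazirani's positioned model,
for a unidirectional machine `M` with direction assignment `D` (BV 1997, Def. 3.14). With the
wires and classical sub-programs of `QTMCircuitLayout.lean` and the gate set
`yaoGateSet M D = Clifford+T ∪ {localGate M D}` of `QTMCircuitGateSet.lean`: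

* `ywEquiv` — the wires `YW M n W` as the wires `Fin (n + anc M n W)` of a circuit, the input
  wires first (`ywEquiv_inp`); `lab v` — an assignment of `YW` as a basis label;
* `compileY ops` — a reversible `ClOp` program on `YW` as a list of gates (re-indexing,
  `toRevList`, `revCompile`, `QGate.ofCT`), acting on basis states by `clEval`
  (`compileY_mulVec_basisState`);
* `stepGates` — **one simulated step**: `fetch`, the local gate on the state register and the
  symbol register, `fetch` (write back), `move`; **`step_mulVec_basisState_enc`**: on the label
  of a configuration `c` of the window it produces `E (U |c⟩)`, where `E` is the linear encoding
  of superpositions of positioned configurations as state vectors and `U = QTM.pevolve`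
  (this is Nishimura–Ozawa's displayed computation in the proof of Thm. 4.3, for a
  unidirectional table); hence `stepMatrix_mulVec_E` and, iterating,
  **`steps_mulVec_E_pstateAt`**: after `s ≤ T` step blocks the circuit holds `E (pstateAt x s)`;
* `yaoCircuit M D n T`, `yaoFamily M D p` — initialisation, `T = p(n)` step blocks, output;
  **`acceptProbOn_yaoFamily`**: for every input `x`,
  `acceptProbOn 0 (yaoFamily M D p) x = M.pacceptProbAt x (p (|x|))` — the family carries out
  `M` for `p(n)` steps EXACTLY (Nishimura–Ozawa 2002, Thm. 4.3 with Lemma/Def. of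
  `t`-simulation, §4; the acceptance functional is Bernstein–Vazirani's single-cell observation
  of Def. 3.4 / ADH Def. 2.1, read on wire `0`); `isOracleFree_yaoFamily`.

Uniformity of `yaoFamily` (its description is printed by a polynomial-time generator) and the
class-level consequences are the subject of the sequels. No named facts are introduced.

## References

* A. C.-C. Yao, *Quantum circuit complexity*, Proc. 34th FOCS (1993) 352–361 [YaoFOCS1993].
* H. Nishimura, M. Ozawa, *Computational complexity of uniform quantum circuit families and
  quantum Turing machines*, Theoret. Comput. Sci. 276 (2002) 147–181 = arXiv:quant-ph/9906095
  [NishimuraOzawa2002]: §4 (`t`-simulation), Thm. 4.3 and its proof.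
* E. Bernstein, U. Vazirani, *Quantum complexity theory*, SIAM J. Comput. 26 (1997) 1411–1473
  [BernsteinVaziraniSICOMP1997]: Def. 3.2, Def. 3.4, Def. 3.14.
* M. A. Nielsen, I. L. Chuang, *Quantum Computation and Quantum Information*, CUP 2010, §3.2.5,
  §4.3 [NielsenChuang2010].
-/

noncomputable section

namespace Literature.Computability.QuantumComplexity

namespace YaoSim

open Cryptography QTM Function Turing Matrix Finsupp
open scoped BigOperators

variable (M : QTM)

/-! ### The wires as circuit wires -/

/-- The number of non-input wires: state register, symbol register, direction and answer wires,
`W` cells of `|Σ|` wires and the head track. [cite: NishimuraOzawa2002, Thm. 4.3 (proof)] -/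
def anc (W : ℕ) : ℕ := kq M + ks M + 1 + 1 + W * ks M + W

/-- The non-input wires as a nested sum of finite types. [folklore] -/
abbrev RestSum (W : ℕ) : Type :=
  ((((Fin (kq M) ⊕ Fin (ks M)) ⊕ Fin 1) ⊕ Fin 1) ⊕ (Fin W × Fin (ks M))) ⊕ Fin W

/-- The nested sum of the non-input wires as `Fin (anc M W)`. [folklore] -/
def restEquiv (W : ℕ) : RestSum M W ≃ Fin (anc M W) :=
  (Equiv.sumCongr
    ((Equiv.sumCongr
      ((Equiv.sumCongr
        ((Equiv.sumCongr finSumFinEquiv (Equiv.refl (Fin 1))).trans finSumFinEquiv)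
        (Equiv.refl (Fin 1))).trans finSumFinEquiv)
      finProdFinEquiv).trans finSumFinEquiv)
    (Equiv.refl (Fin W))).trans finSumFinEquiv

variable (n W : ℕ)

/-- The wires `YW M n W` as the sum of the input wires and the rest. [folklore] -/
def toSum : YW M n W → Fin n ⊕ RestSum M W
  | .inp i => Sum.inl i
  | .st q => Sum.inr (Sum.inl (Sum.inl (Sum.inl (Sum.inl (Sum.inl (Fintype.equivFin M.Λ q))))))
  | .reg τ => Sum.inr (Sum.inl (Sum.inl (Sum.inl (Sum.inl (Sum.inr (Fintype.equivFin M.Γ τ))))))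
  | .dir => Sum.inr (Sum.inl (Sum.inl (Sum.inl (Sum.inr 0))))
  | .ans => Sum.inr (Sum.inl (Sum.inl (Sum.inr 0)))
  | .cell j τ => Sum.inr (Sum.inl (Sum.inr (j, Fintype.equivFin M.Γ τ)))
  | .head j => Sum.inr (Sum.inr j)

/-- The inverse of `toSum`. [folklore] -/
def ofSum : Fin n ⊕ RestSum M W → YW M n W
  | Sum.inl i => .inp i
  | Sum.inr (Sum.inl (Sum.inl (Sum.inl (Sum.inl (Sum.inl i))))) => .st ((Fintype.equivFin M.Λ).symm i)
  | Sum.inr (Sum.inl (Sum.inl (Sum.inl (Sum.inl (Sum.inr i))))) => .reg ((Fintype.equivFin M.Γ).symm i)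
  | Sum.inr (Sum.inl (Sum.inl (Sum.inl (Sum.inr _)))) => .dir
  | Sum.inr (Sum.inl (Sum.inl (Sum.inr _))) => .ans
  | Sum.inr (Sum.inl (Sum.inr (j, i))) => .cell j ((Fintype.equivFin M.Γ).symm i)
  | Sum.inr (Sum.inr j) => .head j

/-- `YW M n W ≃ Fin n ⊕ RestSum M W`. [folklore] -/
def sumEquiv : YW M n W ≃ Fin n ⊕ RestSum M W where
  toFun := toSum M n W
  invFun := ofSum M n W
  left_inv i := by cases i <;> simp [toSum, ofSum]
  right_inv s := by
    rcases s with i | (((((i | i) | i) | i) | ⟨j, i⟩) | j) <;>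
      simp [toSum, ofSum, Fin.fin_one_eq_zero]

/-- **The wires as circuit wires** `Fin (n + anc M W)`: input wire `i` is wire `i`
(`ywEquiv_inp`), the other wires follow. [folklore] -/
def ywEquiv : YW M n W ≃ Fin (n + anc M W) :=
  (sumEquiv M n W).trans ((Equiv.sumCongr (Equiv.refl (Fin n)) (restEquiv M W)).trans finSumFinEquiv)

variable {M n W}

/-- Input wire `i` is circuit wire `i`. [folklore] -/
@[simp] theorem ywEquiv_inp (i : Fin n) : ywEquiv M n W (.inp i) = Fin.castAdd (anc M W) i := rfl

/-- The non-input wires are the circuit wires from `n` on. [folklore] -/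
theorem ywEquiv_of_ne_inp {i : YW M n W} (hi : ∀ k, i ≠ .inp k) :
    ∃ r : Fin (anc M W), ywEquiv M n W i = Fin.natAdd n r := by
  cases i with
  | inp k => exact absurd rfl (hi k)
  | _ => exact ⟨_, rfl⟩

/-- The values of the circuit wires of the state register: `n + (number of q)`. [folklore] -/
theorem val_ywEquiv_st (q : M.Λ) : (ywEquiv M n W (.st q) : ℕ) = n + Fintype.equivFin M.Λ q := rfl

/-- An assignment of the wires as a basis label of the circuit register. [folklore] -/
def lab (v : YW M n W → Bool) : QReg (n + anc M W) := v ∘ (ywEquiv M n W).symm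

/-- Reading a label at the circuit wire of `i`. [folklore] -/
@[simp] theorem lab_apply_ywEquiv (v : YW M n W → Bool) (i : YW M n W) :
    lab v (ywEquiv M n W i) = v i := by
  simp [lab]

/-- `lab` is injective. [folklore] -/
theorem lab_injective : Injective (lab (M := M) (n := n) (W := W)) := fun v v' h => by
  funext i
  rw [← lab_apply_ywEquiv v i, ← lab_apply_ywEquiv v' i, h]

/-! ### Compiled classical programs -/

section Compile

variable (D : M.Λ → Dir)

/-- The re-indexed program is well formed. [folklore] -/
theorem wf_map_ywEquiv {ops : List (ClOp (YW M n W))} (h : ∀ op ∈ ops, op.WF) :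
    ∀ op ∈ ops.map (ClOp.map (ywEquiv M n W)), op.WF := fun op hop => by
  obtain ⟨op', hop', rfl⟩ := List.mem_map.1 hop
  exact (h op' hop').map (ywEquiv M n W).injective

/-- **Compilation** of a well-formed reversible program on the wires `YW` into gates over
`yaoGateSet M D`: re-index to circuit wires, then `revCompile` (exact Clifford+`T` words for
`NOT`, `CNOT`, Toffoli) transported into the gate set. [cite: NielsenChuang2010, §3.2.5] -/
def compileY (ops : List (ClOp (YW M n W))) (h : ∀ op ∈ ops, op.WF) :
    List (QGate (yaoGateSet M D) (n + anc M W)) :=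
  (revCompile (toRevList (ops.map (ClOp.map (ywEquiv M n W))) (wf_map_ywEquiv h))).map (QGate.ofCT D)

/-- Compiled programs are oracle-free. [folklore] -/
theorem isOracleFree_of_mem_compileY {ops : List (ClOp (YW M n W))} (h : ∀ op ∈ ops, op.WF)
    {γ : QGate (yaoGateSet M D) (n + anc M W)} (hγ : γ ∈ compileY D ops h) : γ.IsOracleFree := by
  simp only [compileY, List.mem_map] at hγ
  obtain ⟨γ', hγ', rfl⟩ := hγ
  exact isOracleFree_ofCT D (revCompile_isOracleFree _ γ' hγ')

/-- **A compiled program acts on basis states by its classical semantics**: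
`|lab v⟩ ↦ |lab (clEval ops v)⟩`. [cite: NielsenChuang2010, §3.2.5] -/
theorem compileY_mulVec_basisState (A : Language Bool) {ops : List (ClOp (YW M n W))}
    (h : ∀ op ∈ ops, op.WF) (v : YW M n W → Bool) :
    (⟨compileY D ops h⟩ : QCircuit (yaoGateSet M D) (n + anc M W)).toMatrix A *ᵥ basisState (lab v) =
      basisState (lab (clEval ops v)) := by
  rw [compileY, toMatrix_mapOfCT_revCompile_mulVec_basisState, revEval_toRevList, lab,
    clEval_map_equiv]
  have : (v ∘ ⇑(ywEquiv M n W).symm) ∘ ⇑(ywEquiv M n W) = v := by funext i; simp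
  rw [this]
  rfl

end Compile

/-! ### The local gate on the state and symbol registers -/

section LocalGate

variable (M n W) in
/-- The wires of the state register followed by the symbol register, indexed by
`Fin (|Q| + |Σ|)` in the order of the codes. [folklore] -/
def srWire : Fin (kq M + ks M) → YW M n W :=
  Fin.append (fun i => YW.st ((Fintype.equivFin M.Λ).symm i))
    (fun i => YW.reg ((Fintype.equivFin M.Γ).symm i))

/-- `srWire` is injective. [folklore] -/
theorem srWire_injective : Injective (srWire M n W) := by
  intro a b h
  induction a using Fin.addCases with
  | left a =>
    induction b using Fin.addCases with
    | left b => simpa [srWire] using h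
    | right b => simp [srWire] at h
  | right a =>
    induction b using Fin.addCases with
    | left b => simp [srWire] at h
    | right b => simpa [srWire] using h

variable (M n W) in
/-- The placement of the local gate: the circuit wires of the two registers. [folklore] -/
def eSR : Fin (kq M + ks M) ↪ Fin (n + anc M W) :=
  ⟨fun i => ywEquiv M n W (srWire M n W i), (ywEquiv M n W).injective.comp srWire_injective⟩

/-- A label restricted to the placement of the local gate reads the two registers. [folklore] -/
theorem lab_comp_eSR (v : YW M n W → Bool) : lab v ∘ eSR M n W = v ∘ srWire M n W := by
  funext i; simp [eSR]

/-- The range of the placement: the circuit wires of state and register wires. [folklore] -/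
theorem mem_range_eSR_iff (p : Fin (n + anc M W)) :
    p ∈ Set.range (eSR M n W) ↔
      (∃ q, (ywEquiv M n W).symm p = .st q) ∨ ∃ τ, (ywEquiv M n W).symm p = .reg τ := by
  constructor
  · rintro ⟨i, rfl⟩
    simp only [eSR, Embedding.coeFn_mk, Equiv.symm_apply_apply]
    induction i using Fin.addCases with
    | left i => exact Or.inl ⟨(Fintype.equivFin M.Λ).symm i, by simp [srWire]⟩
    | right i => exact Or.inr ⟨(Fintype.equivFin M.Γ).symm i, by simp [srWire]⟩
  · rintro (⟨q, hq⟩ | ⟨τ, hτ⟩)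
    · refine ⟨Fin.castAdd _ (Fintype.equivFin M.Λ q), ?_⟩
      simp only [eSR, Embedding.coeFn_mk, srWire, Fin.append_left, Equiv.symm_apply_apply]
      rw [← hq, Equiv.apply_symm_apply]
    · refine ⟨Fin.natAdd _ (Fintype.equivFin M.Γ τ), ?_⟩
      simp only [eSR, Embedding.coeFn_mk, srWire, Fin.append_right, Equiv.symm_apply_apply]
      rw [← hτ, Equiv.apply_symm_apply]

variable {x : List Bool} {T s : ℕ} {c : M.PCfg}

/-- After `fetch` the two registers hold the code of (state, scanned symbol). [cite: NishimuraOzawa2002, Thm. 4.3 (proof)] -/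
theorem lab_fetched_comp_eSR (x : List Bool) (T : ℕ) (c : M.PCfg) :
    lab (fetched x T c) ∘ eSR M x.length (Wd x.length T) = codeSR M (c.1.q, c.1.tape.head) := by
  rw [lab_comp_eSR]
  funext i
  induction i using Fin.addCases with
  | left i => simp [srWire, codeSR, fetched, enc, Equiv.eq_symm_apply, eq_comm]
  | right i => simp [srWire, codeSR, fetched, Equiv.eq_symm_apply, eq_comm]

/-- Overwriting the registers of the fetched label with the code of `(q', b)` gives the label
`applied`. [cite: NishimuraOzawa2002, Thm. 4.3 (proof)] -/
theorem extend_eSR_codeSR_fetched (x : List Bool) (T : ℕ) (c : M.PCfg) (y : M.Λ × M.Γ) :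
    Function.extend (eSR M x.length (Wd x.length T)) (codeSR M y) (lab (fetched x T c)) =
      lab (applied x T c y.1 y.2) := by
  funext p
  by_cases hp : p ∈ Set.range (eSR M x.length (Wd x.length T))
  · obtain ⟨i, rfl⟩ := hp
    rw [(eSR M _ _).injective.extend_apply]
    show codeSR M y i = lab (applied x T c y.1 y.2) (ywEquiv M _ _ (srWire M _ _ i))
    rw [lab_apply_ywEquiv]
    induction i using Fin.addCases with
    | left i => simp [srWire, codeSR, applied, Equiv.eq_symm_apply, eq_comm]
    | right i => simp [srWire, codeSR, applied, Equiv.eq_symm_apply, eq_comm]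
  · rw [Function.extend_apply' _ _ _ (fun ⟨i, hi⟩ => hp ⟨i, hi⟩)]
    simp only [lab, Function.comp_apply]
    have h₁ : ∀ q, (ywEquiv M _ _).symm p ≠ .st q := fun q hq =>
      hp ((mem_range_eSR_iff p).2 (Or.inl ⟨q, hq⟩))
    have h₂ : ∀ τ, (ywEquiv M _ _).symm p ≠ .reg τ := fun τ hτ =>
      hp ((mem_range_eSR_iff p).2 (Or.inr ⟨τ, hτ⟩))
    generalize (ywEquiv M x.length (Wd x.length T)).symm p = i at h₁ h₂ ⊢
    cases i with
    | st q => exact absurd rfl (h₁ q)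
    | reg τ => exact absurd rfl (h₂ τ)
    | _ => rfl

variable (D : M.Λ → Dir)

variable (M n W) in
/-- The local gate placed on the two registers. [cite: NishimuraOzawa2002, Thm. 4.3 (proof)] -/
def locGate : QGate (yaoGateSet M D) (n + anc M W) :=
  QGate.gate (YOp.loc : (yaoGateSet M D).Op) (eSR M n W)

/-- **The local gate on a fetched label**: the superposition, over the new pairs `(q', b)`, of
the labels `applied c q' b` with amplitudes `A_D[(q', b), (q, a)]` — Nishimura–Ozawa's condition
(i) on `G₁`. [cite: NishimuraOzawa2002, Thm. 4.3 (proof)] -/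
theorem locGate_mulVec_fetched (A : Language Bool) (x : List Bool) (T : ℕ) (c : M.PCfg) :
    (locGate M x.length (Wd x.length T) D).toMatrix A *ᵥ basisState (lab (fetched x T c)) =
      ∑ y : M.Λ × M.Γ, M.localMat D y (c.1.q, c.1.tape.head) • basisState (lab (applied x T c y.1 y.2)) := by
  rw [locGate, QGate.toMatrix_gate]
  show placeGate (eSR M _ _) (localGate M D) *ᵥ _ = _
  rw [placeGate_mulVec_basisState_eq_sum, lab_fetched_comp_eSR]
  simp_rw [localGate_apply_codeSR, Finset.sum_smul, ite_smul, zero_smul]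
  rw [Finset.sum_comm]
  refine Finset.sum_congr rfl fun y _ => ?_
  rw [Finset.sum_ite_eq' Finset.univ (codeSR M y), if_pos (Finset.mem_univ _),
    extend_eSR_codeSR_fetched]

end LocalGate

/-! ### The encoding of superpositions and one simulated step -/

section Step

variable (D : M.Λ → Dir)

/-- **The linear encoding of superpositions** of positioned configurations as state vectors of
the circuit register: `|c⟩ ↦ |lab (enc x T c)⟩`. [cite: NishimuraOzawa2002, Thm. 4.3 (proof)] -/
def E (x : List Bool) (T : ℕ) : (M.PCfg →₀ ℂ) →ₗ[ℂ] (QReg (x.length + anc M (Wd x.length T)) → ℂ) :=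
  Finsupp.linearCombination ℂ fun c => basisState (lab (enc x T c))

/-- `E` on a basis configuration. [folklore] -/
@[simp] theorem E_single (x : List Bool) (T : ℕ) (c : M.PCfg) (a : ℂ) :
    E x T (Finsupp.single c a) = a • basisState (lab (enc x T c)) := by
  simp [E, Finsupp.linearCombination_single]

variable (M) in
/-- **One simulated step**: fetch the scanned symbol, apply the local gate to (state, symbol),
write back, move the head marker (Nishimura–Ozawa 2002, proof of Thm. 4.3: `K₂K₁`). [cite: NishimuraOzawa2002, Thm. 4.3 (proof)] -/
def stepGates (n T : ℕ) : List (QGate (yaoGateSet M D) (n + anc M (Wd n T))) :=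
  compileY D (fetch M n (Wd n T)) (fun _ h => wf_of_mem_fetch h) ++
    ([locGate M n (Wd n T) D] ++
      (compileY D (fetch M n (Wd n T)) (fun _ h => wf_of_mem_fetch h) ++
        compileY D (move M D n (Wd n T)) (fun _ h => wf_of_mem_move h)))

variable (M) in
/-- The matrix of one simulated step (empty oracle; the gates are oracle-free). [folklore] -/
def stepMatrix (n T : ℕ) : Matrix (QReg (n + anc M (Wd n T))) (QReg (n + anc M (Wd n T))) ℂ :=
  (⟨stepGates M D n T⟩ : QCircuit (yaoGateSet M D) _).toMatrix 0

/-- The matrix of a concatenation of gate lists. [folklore] -/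
theorem toMatrix_mk_append {G : QGateSet} {N : ℕ} (A : Language Bool) (l₁ l₂ : List (QGate G N)) :
    (⟨l₁ ++ l₂⟩ : QCircuit G N).toMatrix A = (⟨l₂⟩ : QCircuit G N).toMatrix A * (⟨l₁⟩ : QCircuit G N).toMatrix A :=
  QCircuit.toMatrix_append A ⟨l₁⟩ ⟨l₂⟩

/-- The matrix of a singleton gate list. [folklore] -/
theorem toMatrix_mk_singleton {G : QGateSet} {N : ℕ} (A : Language Bool) (γ : QGate G N) :
    (⟨[γ]⟩ : QCircuit G N).toMatrix A = γ.toMatrix A := by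
  rw [QCircuit.toMatrix_cons, QCircuit.toMatrix_nil, Matrix.one_mul]

variable {x : List Bool} {T s : ℕ}

/-- **One step on the label of a configuration of the window** (`s < T` steps done): the step
block produces the encoding of `U |c⟩`,
`∑_{(q', τ)} A_D[(q', τ), (q, T(ξ))] |lab (enc (q', T_ξ^τ, ξ ± 1))⟩`
(Nishimura–Ozawa 2002, proof of Thm. 4.3, the displayed transformation, for a unidirectional
table). [cite: NishimuraOzawa2002, Thm. 4.3 (proof)] -/
theorem step_mulVec_basisState_enc (hD : M.IsUnidirectionalWith D) {c : M.PCfg}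
    (h : PCfg.InWindow x.length s c) (hs : s < T) :
    stepMatrix M D x.length T *ᵥ basisState (lab (enc x T c)) = E x T (M.pevolve (Finsupp.single c 1)) := by
  rw [stepMatrix, stepGates, toMatrix_mk_append, toMatrix_mk_append, toMatrix_mk_append,
    toMatrix_mk_singleton, ← Matrix.mulVec_mulVec, ← Matrix.mulVec_mulVec, ← Matrix.mulVec_mulVec,
    compileY_mulVec_basisState, clEval_fetch_enc h hs.le, locGate_mulVec_fetched,
    Matrix.mulVec_sum, Matrix.mulVec_sum, pevolve_single_one_of_unidirectional hD, map_sum]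
  refine Finset.sum_congr rfl fun y _ => ?_
  rw [Matrix.mulVec_smul, Matrix.mulVec_smul, compileY_mulVec_basisState,
    clEval_fetch_applied h hs.le, compileY_mulVec_basisState, clEval_move_written h hs,
    map_smul, E_single, one_smul]

/-- Homogeneity of one step on a basis configuration: `U (a |c⟩) = a • U |c⟩`. [folklore] -/
theorem pevolve_single_eq_smul (c : M.PCfg) (a : ℂ) :
    M.pevolve (Finsupp.single c a) = a • M.pevolve (Finsupp.single c 1) := by
  rw [M.pevolve_single_eq_sum, M.pevolve_single_eq_sum, Finset.smul_sum]
  exact Finset.sum_congr rfl fun u _ => by rw [one_mul, smul_smul]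

/-- **One step on an encoded superposition supported in the window.** [cite: NishimuraOzawa2002, Thm. 4.3 (proof)] -/
theorem stepMatrix_mulVec_E (hD : M.IsUnidirectionalWith D) (ψ : M.PCfg →₀ ℂ)
    (hψ : ∀ c ∈ ψ.support, PCfg.InWindow x.length s c) (hs : s < T) :
    stepMatrix M D x.length T *ᵥ E x T ψ = E x T (M.pevolve ψ) := by
  conv_lhs => rw [← Finsupp.sum_single ψ]
  rw [M.pevolve_eq_finsuppSum ψ, map_finsuppSum, map_finsuppSum, Finsupp.sum, Finsupp.sum,
    Matrix.mulVec_sum]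
  refine Finset.sum_congr rfl fun c hc => ?_
  rw [E_single, Matrix.mulVec_smul, step_mulVec_basisState_enc D hD (hψ c hc) hs,
    pevolve_single_eq_smul c (ψ c), map_smul]

/-- **After `s ≤ T` step blocks the circuit holds the encoding of the `s`-th superposition.** [cite: NishimuraOzawa2002, Thm. 4.3 (proof)] -/
theorem steps_mulVec_E_pstateAt (hD : M.IsUnidirectionalWith D) (x : List Bool) :
    ∀ s : ℕ, s ≤ T →
      (stepMatrix M D x.length T ^ s) *ᵥ E x T (Finsupp.single (M.pinit x) 1) = E x T (M.pstateAt x s)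
  | 0, _ => by simp [pstateAt]
  | s + 1, hs => by
    rw [pow_succ', ← Matrix.mulVec_mulVec, steps_mulVec_E_pstateAt hD x s (by omega),
      stepMatrix_mulVec_E D hD _ (support_pstateAt_inWindow x s) (by omega), pstateAt_succ]

end Step

/-! ### The circuits, the family, and the exact simulation -/

section Family

variable (D : M.Λ → Dir)

variable (M) in
/-- **The simulating circuit** for inputs of length `n` and `T` steps: initialisation, `T` step
blocks, output (Nishimura–Ozawa 2002, proof of Thm. 4.3: `K_𝒢 = (K₂K₁)^t`, here conjugated by
the loading of the input and the reading of the accepting state). [cite: NishimuraOzawa2002, Thm. 4.3 (proof)] -/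
def yaoGates (n T : ℕ) : List (QGate (yaoGateSet M D) (n + anc M (Wd n T))) :=
  compileY D (initOps M n T) (fun _ h => wf_of_mem_initOps h) ++
    ((List.replicate T (stepGates M D n T)).flatten ++
      compileY D (outputOps M n (Wd n T)) (fun _ h => wf_of_mem_outputOps h))

variable (M) in
/-- The simulating circuit as a `QCircuit`. [cite: NishimuraOzawa2002, Thm. 4.3] -/
def yaoCircuit (n T : ℕ) : QCircuit (yaoGateSet M D) (n + anc M (Wd n T)) := ⟨yaoGates M D n T⟩

variable (M) in
/-- **The simulating family** for the polynomial time bound `p`: on inputs of length `n`,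
`p(n)` steps are simulated. [cite: NishimuraOzawa2002, Thm. 4.3] -/
def yaoFamily (p : Polynomial ℕ) : QCircuitFamily (yaoGateSet M D) where
  ancillas n := anc M (Wd n (p.eval n))
  circ n := yaoCircuit M D n (p.eval n)

/-- The step gates are oracle-free. [folklore] -/
theorem isOracleFree_of_mem_stepGates {n T : ℕ} {γ : QGate (yaoGateSet M D) (n + anc M (Wd n T))}
    (hγ : γ ∈ stepGates M D n T) : γ.IsOracleFree := by
  simp only [stepGates, List.mem_append, List.mem_singleton] at hγ
  rcases hγ with h | h | h | h
  · exact isOracleFree_of_mem_compileY D _ h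
  · subst h; trivial
  · exact isOracleFree_of_mem_compileY D _ h
  · exact isOracleFree_of_mem_compileY D _ h

/-- The simulating circuits are oracle-free. [folklore] -/
theorem isOracleFree_yaoCircuit (n T : ℕ) : (yaoCircuit M D n T).IsOracleFree := by
  intro γ hγ
  simp only [yaoCircuit, yaoGates, List.mem_append, List.mem_flatten, List.mem_replicate] at hγ
  rcases hγ with h | ⟨l, ⟨-, rfl⟩, h⟩ | h
  · exact isOracleFree_of_mem_compileY D _ h
  · exact isOracleFree_of_mem_stepGates D h
  · exact isOracleFree_of_mem_compileY D _ h

/-- **The simulating family is oracle-free.** [folklore] -/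
theorem isOracleFree_yaoFamily (p : Polynomial ℕ) : (yaoFamily M D p).IsOracleFree :=
  fun n => isOracleFree_yaoCircuit D n (p.eval n)

/-- The matrix of `T` copies of a gate list is the `T`-th power. [folklore] -/
theorem toMatrix_mk_flatten_replicate {G : QGateSet} {N : ℕ} (A : Language Bool) (l : List (QGate G N)) :
    ∀ T : ℕ, (⟨(List.replicate T l).flatten⟩ : QCircuit G N).toMatrix A = (⟨l⟩ : QCircuit G N).toMatrix A ^ T
  | 0 => by simp
  | T + 1 => by
    rw [List.replicate_succ, List.flatten_cons, toMatrix_mk_append, toMatrix_mk_flatten_replicate A l T,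
      pow_succ]

/-- The padded input is the label of the input assignment. [folklore] -/
theorem padInput_eq_lab_inputAssign (x : List Bool) (T : ℕ) :
    padInput x.get (anc M (Wd x.length T)) = lab (inputAssign M x T) := by
  funext p
  induction p using Fin.addCases with
  | left i =>
    rw [show Fin.castAdd _ i = ywEquiv M x.length (Wd x.length T) (.inp i) from rfl, lab_apply_ywEquiv]
    simp [padInput, Fin.append_left, inputAssign]
  | right r =>
    simp only [padInput, Fin.append_right, lab, Function.comp_apply]
    have : ∀ k, (ywEquiv M x.length (Wd x.length T)).symm (Fin.natAdd x.length r) ≠ .inp k := by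
      intro k hk
      have := congrArg (ywEquiv M x.length (Wd x.length T)) hk
      rw [Equiv.apply_symm_apply, ywEquiv_inp] at this
      exact absurd (congrArg Fin.val this) (by simp; omega)
    generalize (ywEquiv M x.length (Wd x.length T)).symm (Fin.natAdd x.length r) = i at this ⊢
    cases i with
    | inp k => exact absurd rfl (this k)
    | _ => rfl

/-- **The output state of the simulating circuit**: the superposition, over the configurations
`c` of the final superposition of `M`, of the final labels of `c` with the amplitudes of `M`. [cite: NishimuraOzawa2002, Thm. 4.3 (proof)] -/
theorem runOn_yaoCircuit (hD : M.IsUnidirectionalWith D) (x : List Bool) (T : ℕ) :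
    (yaoCircuit M D x.length T).runOn 0 (basisState (padInput x.get (anc M (Wd x.length T)))) =
      (M.pstateAt x T).sum fun c a => a • basisState (lab (final c (enc x T c))) := by
  rw [QCircuit.runOn, yaoCircuit, yaoGates, toMatrix_mk_append, toMatrix_mk_append,
    ← Matrix.mulVec_mulVec, ← Matrix.mulVec_mulVec, padInput_eq_lab_inputAssign,
    compileY_mulVec_basisState, clEval_initOps_inputAssign, toMatrix_mk_flatten_replicate,
    ← stepMatrix]
  have h1 : basisState (lab (enc x T (M.pinit x))) = E x T (Finsupp.single (M.pinit x) 1) := by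
    rw [E_single, one_smul]
  rw [h1, steps_mulVec_E_pstateAt D hD x T le_rfl]
  conv_lhs => rw [← Finsupp.sum_single (M.pstateAt x T), map_finsuppSum]
  rw [Finsupp.sum, Matrix.mulVec_sum, Finsupp.sum]
  refine Finset.sum_congr rfl fun c _ => ?_
  rw [E_single, Matrix.mulVec_smul, compileY_mulVec_basisState, clEval_outputOps_enc]

/-- **Born weights of a superposition of distinct basis states.** If `f` is injective on the
support of `ψ`, then `∑_y g(y) |(∑_c ψ_c |f c⟩)(y)|² = ∑_c g(f c) |ψ_c|²`. [folklore] -/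
theorem sum_mul_normSq_sum_basisState {ι : Type*} {N : ℕ} (ψ : ι →₀ ℂ) (f : ι → QReg N)
    (hf : Set.InjOn f ψ.support) (g : QReg N → ℝ) :
    ∑ y : QReg N, g y * ‖(ψ.sum fun i a => a • basisState (f i)) y‖ ^ 2 =
      ψ.sum fun i a => g (f i) * ‖a‖ ^ 2 := by
  classical
  have happ : ∀ y, (ψ.sum fun i a => a • basisState (f i)) y =
      ∑ i ∈ ψ.support, if y = f i then ψ i else 0 := by
    intro y
    rw [Finsupp.sum, Finset.sum_apply]
    refine Finset.sum_congr rfl fun i _ => ?_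
    simp [basisState_apply]
  simp_rw [happ]
  -- split the sum over `y` into the image of the support and the rest
  have hval : ∀ i ∈ ψ.support, (∑ j ∈ ψ.support, if f i = f j then ψ j else 0) = ψ i := by
    intro i hi
    rw [Finset.sum_eq_single i]
    · rw [if_pos rfl]
    · intro j hj hji
      rw [if_neg fun h => hji (hf hj hi h.symm)]
    · exact fun h => absurd hi h
  rw [← Finset.sum_subset (Finset.subset_univ (ψ.support.image f))]
  · rw [Finset.sum_image fun i hi j hj h => hf hi hj h, Finsupp.sum]
    refine Finset.sum_congr rfl fun i hi => ?_
    rw [hval i hi]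
  · intro y _ hy
    rw [Finset.sum_eq_zero]
    · simp
    · intro i hi
      rw [if_neg]
      exact fun h => hy (Finset.mem_image.2 ⟨i, hi, h.symm⟩)

/-- Wire `0` of the circuit is `wire0`. [folklore] -/
theorem ywEquiv_wire0 {n W : ℕ} (h : 0 < n + anc M W) :
    ywEquiv M n W (wire0 M n W) = ⟨0, h⟩ := by
  unfold wire0
  split_ifs with hn
  · rfl
  · apply Fin.ext
    rw [val_ywEquiv_st]
    simp only [Equiv.apply_symm_apply]
    omega

/-- The register of the circuit is non-empty. [folklore] -/
theorem anc_pos (W : ℕ) : 0 < anc M W := by unfold anc; omega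

/-- **Exact simulation (Nishimura–Ozawa 2002, Thm. 4.3, for unidirectional machines in
Bernstein–Vazirani's model).** The probability of reading `1` on wire `0` of the simulating
circuit run on `|x⟩|0…0⟩` equals the probability that `M`, started on `x` and observed after
exactly `T` steps, is in its accepting state (positioned model, `QTM.pacceptProbAt`). [cite: NishimuraOzawa2002, Thm. 4.3] -/
theorem acceptProb_yaoCircuit (hD : M.IsUnidirectionalWith D) (x : List Bool) (T : ℕ) :
    (yaoCircuit M D x.length T).acceptProb 0 x.get = M.pacceptProbAt x T := by
  have hN : 0 < x.length + anc M (Wd x.length T) := Nat.add_pos_right _ (anc_pos _)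
  unfold QCircuit.acceptProb
  simp only [hN, dif_pos]
  rw [runOn_yaoCircuit D hD x T]
  have hinj : Set.InjOn (fun c => lab (final c (enc x T c))) (↑(M.pstateAt x T).support : Set M.PCfg) := by
    intro c hc c' hc' h
    rw [Finset.mem_coe] at hc hc'
    exact final_enc_injective_of_inWindow (support_pstateAt_inWindow x T c hc)
      (support_pstateAt_inWindow x T c' hc') (lab_injective h)
  have key := sum_mul_normSq_sum_basisState (M.pstateAt x T) (fun c => lab (final c (enc x T c))) hinj
    (fun y => if y ⟨0, hN⟩ then 1 else 0)
  simp only [ite_mul, one_mul, zero_mul] at key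
  rw [key, pacceptProbAt]
  refine Finsupp.sum_congr fun c _ => ?_
  rw [← ywEquiv_wire0 hN, lab_apply_ywEquiv, final_wire0]
  by_cases hq : c.1.q = M.accept <;> simp [hq]

/-- **Exact simulation by the family** (Nishimura–Ozawa 2002, Thm. 4.3; Yao 1993): for a
unidirectional machine `M` with direction assignment `D` and every polynomial `p`, the family
`yaoFamily M D p` of circuits over `yaoGateSet M D` satisfies, for every input `x`,
`acceptProbOn 0 x = pacceptProbAt x (p |x|)`. [cite: NishimuraOzawa2002, Thm. 4.3] -/
theorem acceptProbOn_yaoFamily (hD : M.IsUnidirectionalWith D) (p : Polynomial ℕ) (x : List Bool) :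
    (yaoFamily M D p).acceptProbOn 0 x = M.pacceptProbAt x (p.eval x.length) :=
  acceptProb_yaoCircuit D hD x (p.eval x.length)

end Family

end YaoSim

end Literature.Computability.QuantumComplexity

end
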